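import Summits.KontsevichZagierPeriods.KontsevichZagierPeriods.Theorems.CompleteModGammaSector.Negative.FirstCoordinateCdf
import Literature.NumberTheory.Transcendental.SemialgebraicMonotonicityDefinable

/-!
# Newton–Leibniz over the point is window-semialgebraic

Support for the negative side of crux `CompleteModGammaSector` (§5D of
`Cruxes/CompleteModGammaSector/Disproof.lean`, cdisprove gen 1): for a rule-(3) move `[[a₀,b₀], F'] −
[pt, F(b₀) − F(a₀)]`, `Cdf` is `q ↦ F (clamp q) − F (a₀)` (FTC on the clipped band,
`setIntegral_band_fin_one`), and `s ↦ F (clamp (2+s)) − F (a₀)` is `ℝ`-semialgebraic on `[0,1]`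
(Tarski–Seidenberg closure properties from the tree; `min`/`max` through `|·|`):
`windowSemialg_Cdf_newtonLeibniz_zero`.
-/

noncomputable section

open MeasureTheory Set
open scoped BigOperators Topology

namespace Summit.KontsevichZagierPeriods.CompleteModGammaSectorNegative

open Literature.NumberTheory.Transcendental
open Literature.NumberTheory.Transcendental.KZ
open Literature.ModelTheory.ExponentialFields (IsSemialgebraic)

/-! ### §5D Newton–Leibniz over the point (base dimension `0`) is window-semialgebraic -/

/-- Functions on `Fin 1` are determined by their value at `0`. [folklore] -/
theorem fin_one_eq (z : Fin 1 → ℝ) : z = fun _ => z 0 := by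
  funext i
  rw [Subsingleton.elim i 0]

/-- `Fin.snoc` over the empty tuple is the constant tuple. [folklore] -/
theorem snoc_fin_zero (x : Fin 0 → ℝ) (t : ℝ) : (Fin.snoc x t : Fin 1 → ℝ) = fun _ => t := by
  funext i
  have hi : i = Fin.last 0 := Fin.ext (by have := i.isLt; simp only [Fin.val_last]; omega)
  rw [hi, Fin.snoc_last]

/-- `min` through `|·|`. [folklore] -/
theorem min_eq_half (a b : ℝ) : min a b = 1 / 2 * (a + b - |a - b|) := by
  rcases le_total a b with h | h
  · rw [min_eq_left h, abs_of_nonpos (sub_nonpos.mpr h)]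
    ring
  · rw [min_eq_right h, abs_of_nonneg (sub_nonneg.mpr h)]
    ring

/-- `max` through `|·|`. [folklore] -/
theorem max_eq_half (a b : ℝ) : max a b = 1 / 2 * (a + b + |a - b|) := by
  rcases le_total a b with h | h
  · rw [max_eq_right h, abs_of_nonpos (sub_nonpos.mpr h)]
    ring
  · rw [max_eq_left h, abs_of_nonneg (sub_nonneg.mpr h)]
    ring

/-- `min` of real semialgebraic functions is semialgebraic. [cite: BochnakCosteRoy1998, Prop. 2.2.6] -/
theorem IsSemialgebraicFunOn.min' {m : ℕ} {s : Set (Fin m → ℝ)} {f g : (Fin m → ℝ) → ℝ}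
    (hf : IsSemialgebraicFunOn ℝ s f) (hg : IsSemialgebraicFunOn ℝ s g) :
    IsSemialgebraicFunOn ℝ s (fun x => min (f x) (g x)) := by
  have hs : IsSemialgebraic ℝ s := IsSemialgebraicFunOn.isSemialgebraic_holds hf
  have hhalf : IsSemialgebraicFunOn ℝ s (fun _ => (1 / 2 : ℝ)) :=
    (isSemialgebraicFunOn_aeval hs (MvPolynomial.C (1 / 2 : ℝ))).congr fun x _ => by simp
  have h1 : IsSemialgebraicFunOn ℝ s (f - g) := IsSemialgebraicFunOn.sub_holds hf hg
  have h2 : IsSemialgebraicFunOn ℝ s (fun x => |(f - g) x|) := h1.abs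
  have h3 : IsSemialgebraicFunOn ℝ s (f + g) := IsSemialgebraicFunOn.add_holds hf hg
  have h4 : IsSemialgebraicFunOn ℝ s ((f + g) - fun x => |(f - g) x|) := IsSemialgebraicFunOn.sub_holds h3 h2
  have h5 : IsSemialgebraicFunOn ℝ s ((fun _ => (1 / 2 : ℝ)) * ((f + g) - fun x => |(f - g) x|)) :=
    IsSemialgebraicFunOn.mul_holds hhalf h4
  refine h5.congr fun x _ => ?_
  simp only [Pi.mul_apply, Pi.sub_apply, Pi.add_apply, min_eq_half]

/-- `max` of real semialgebraic functions is semialgebraic. [cite: BochnakCosteRoy1998, Prop. 2.2.6] -/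
theorem IsSemialgebraicFunOn.max' {m : ℕ} {s : Set (Fin m → ℝ)} {f g : (Fin m → ℝ) → ℝ}
    (hf : IsSemialgebraicFunOn ℝ s f) (hg : IsSemialgebraicFunOn ℝ s g) :
    IsSemialgebraicFunOn ℝ s (fun x => max (f x) (g x)) := by
  have hs : IsSemialgebraic ℝ s := IsSemialgebraicFunOn.isSemialgebraic_holds hf
  have hhalf : IsSemialgebraicFunOn ℝ s (fun _ => (1 / 2 : ℝ)) :=
    (isSemialgebraicFunOn_aeval hs (MvPolynomial.C (1 / 2 : ℝ))).congr fun x _ => by simp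
  have h1 : IsSemialgebraicFunOn ℝ s (f - g) := IsSemialgebraicFunOn.sub_holds hf hg
  have h2 : IsSemialgebraicFunOn ℝ s (fun x => |(f - g) x|) := h1.abs
  have h3 : IsSemialgebraicFunOn ℝ s (f + g) := IsSemialgebraicFunOn.add_holds hf hg
  have h4 : IsSemialgebraicFunOn ℝ s ((f + g) + fun x => |(f - g) x|) := IsSemialgebraicFunOn.add_holds h3 h2
  have h5 : IsSemialgebraicFunOn ℝ s ((fun _ => (1 / 2 : ℝ)) * ((f + g) + fun x => |(f - g) x|)) :=
    IsSemialgebraicFunOn.mul_holds hhalf h4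
  refine h5.congr fun x _ => ?_
  simp only [Pi.mul_apply, Pi.sub_apply, Pi.add_apply, max_eq_half]

/-- **FTC on a clipped band in `ℝ¹`.** For `a₀ ≤ b₀`, an integrand `f` on the band
`{a₀ ≤ z₀ ≤ b₀}` with a primitive `F₀` (continuous on `[a₀,b₀]`, derivative `f` inside):
`∫_{band ∩ {z₀ ≤ q}} f = F₀ (clamp q) − F₀ a₀`, `clamp q = max a₀ (min q b₀)`. [folklore] -/
theorem setIntegral_band_fin_one {a₀ b₀ : ℝ} {f : (Fin 1 → ℝ) → ℝ} {F₀ : ℝ → ℝ}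
    (hab : a₀ ≤ b₀) (hint : IntegrableOn f {z : Fin 1 → ℝ | a₀ ≤ z 0 ∧ z 0 ≤ b₀})
    (hcont : ContinuousOn F₀ (Icc a₀ b₀))
    (hderiv : ∀ t ∈ Ioo a₀ b₀, HasDerivAt F₀ (f (fun _ => t)) t) (q : ℝ) :
    ∫ z in {z : Fin 1 → ℝ | a₀ ≤ z 0 ∧ z 0 ≤ b₀} ∩ {z | z 0 ≤ q}, f z =
      F₀ (max a₀ (min q b₀)) - F₀ a₀ := by
  rcases lt_or_ge q a₀ with hq | hq
  · have hset : {z : Fin 1 → ℝ | a₀ ≤ z 0 ∧ z 0 ≤ b₀} ∩ {z | z 0 ≤ q} = ∅ := by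
      ext z
      simp only [mem_inter_iff, mem_setOf_eq, mem_empty_iff_false, iff_false, not_and]
      intro h _
      linarith [h.1]
    have hmax : max a₀ (min q b₀) = a₀ := max_eq_left ((min_le_left _ _).trans hq.le)
    rw [hset, Measure.restrict_empty, integral_zero_measure, hmax, sub_self]
  · set m := min q b₀ with hm
    have ham : a₀ ≤ m := le_min hq hab
    have hmb : m ≤ b₀ := min_le_right _ _
    have hmax : max a₀ m = m := max_eq_right ham
    set e := MeasurableEquiv.funUnique (Fin 1) ℝ with he
    have he_apply : ∀ z : Fin 1 → ℝ, e z = z 0 := fun z => rfl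
    have hmp : MeasurePreserving e volume volume := volume_preserving_funUnique (Fin 1) ℝ
    have hset : {z : Fin 1 → ℝ | a₀ ≤ z 0 ∧ z 0 ≤ b₀} ∩ {z | z 0 ≤ q} = e ⁻¹' Icc a₀ m := by
      ext z
      simp only [mem_inter_iff, mem_setOf_eq, mem_preimage, he_apply, mem_Icc, hm, le_min_iff]
      tauto
    have hfz : ∀ z : Fin 1 → ℝ, f z = f (fun _ => e z) := fun z => by
      rw [he_apply]
      exact congrArg f (fin_one_eq z)
    rw [hmax, hset]
    have htrans : ∫ z in e ⁻¹' Icc a₀ m, f z = ∫ t in Icc a₀ m, f (fun _ => t) := by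
      rw [← hmp.setIntegral_preimage_emb e.measurableEmbedding (fun t => f fun _ => t) (Icc a₀ m)]
      exact setIntegral_congr_fun (measurableSet_Icc.preimage e.measurable) fun z _ => hfz z
    rw [htrans, integral_Icc_eq_integral_Ioc, ← intervalIntegral.integral_of_le ham]
    apply intervalIntegral.integral_eq_sub_of_hasDerivAt_of_le ham
      (hcont.mono (Icc_subset_Icc_right hmb)) (fun t ht => hderiv t ⟨ht.1, ht.2.trans_le hmb⟩)
    rw [intervalIntegrable_iff_integrableOn_Icc_of_le ham]
    have h2 : IntegrableOn f (e ⁻¹' Icc a₀ m) := hint.mono_set (by rw [← hset]; exact inter_subset_left)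
    have h3 : IntegrableOn ((fun t => f fun _ => t) ∘ e) (e ⁻¹' Icc a₀ m) := by
      refine h2.congr_fun (fun z _ => hfz z) (measurableSet_Icc.preimage e.measurable)
    exact (hmp.integrableOn_comp_preimage e.measurableEmbedding).mp h3

/-- The window `[0,1] ⊆ ℝ¹` (the variable `s = q − 2`). -/
abbrev window01 : Set (Fin 1 → ℝ) := {x | x 0 ∈ Icc (0 : ℝ) 1}

/-- **A Newton–Leibniz move over the point is window-semialgebraic.** For `r = [[a₀,b₀], F']`,
`r' = [pt, F(b₀) − F(a₀)]`: `Cdf ([r] − [r']) (q) = F (clamp q) − F (a₀)` (FTC on the clipped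
band), and `s ↦ F (clamp (2 + s)) − F (a₀)` is `ℝ`-semialgebraic on `[0,1]` (composition of the
`ℚ`-semialgebraic primitive `F` with the semialgebraic clamp; Tarski–Seidenberg).
[cite: KontsevichZagier2001, §1.2 rule (3)] -/
theorem windowSemialg_Cdf_newtonLeibniz_zero (r : IntegralRep 1) (r' : IntegralRep 0)
    {a b : (Fin 0 → ℝ) → ℝ} {F : (Fin 1 → ℝ) → ℝ}
    (hF : IsSemialgebraicFunOn ℚ r.domain F)
    (hab : ∀ x ∈ r'.domain, a x ≤ b x)
    (hdom : r.domain = {z | (Fin.init z : Fin 0 → ℝ) ∈ r'.domain ∧ a (Fin.init z) ≤ z (Fin.last 0) ∧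
      z (Fin.last 0) ≤ b (Fin.init z)})
    (hcont : ∀ x ∈ r'.domain, ContinuousOn (fun t : ℝ => F (Fin.snoc x t)) (Icc (a x) (b x)))
    (hderiv : ∀ x ∈ r'.domain, ∀ t ∈ Ioo (a x) (b x),
      HasDerivAt (fun s : ℝ => F (Fin.snoc x s)) (r.integrand (Fin.snoc x t)) t) :
    WindowSemialg (Cdf (of r - of r')) := by
  rw [map_sub, Cdf_of_zero, sub_zero]
  set pt : Fin 0 → ℝ := fun i => i.elim0 with hpt
  have hinit : ∀ z : Fin 1 → ℝ, Fin.init z = pt := fun z => Subsingleton.elim _ _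
  by_cases hτ : pt ∈ r'.domain
  · set a₀ := a pt with ha₀
    set b₀ := b pt with hb₀
    have hab₀ : a₀ ≤ b₀ := hab pt hτ
    have hdom' : r.domain = {z : Fin 1 → ℝ | a₀ ≤ z 0 ∧ z 0 ≤ b₀} := by
      rw [hdom]
      ext z
      simp only [mem_setOf_eq, hinit z, hτ, true_and, Fin.last_zero]
      exact Iff.rfl
    set F₀ : ℝ → ℝ := fun t => F (fun _ => t) with hF₀
    have hsnoc : ∀ t : ℝ, (Fin.snoc pt t : Fin 1 → ℝ) = fun _ => t := snoc_fin_zero pt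
    have hcont₀ : ContinuousOn F₀ (Icc a₀ b₀) := by
      have h := hcont pt hτ
      simp only [hsnoc] at h
      exact h
    have hderiv₀ : ∀ t ∈ Ioo a₀ b₀, HasDerivAt F₀ (r.integrand (fun _ => t)) t := by
      intro t ht
      have h := hderiv pt hτ t ht
      simp only [hsnoc] at h
      exact h
    have hint : IntegrableOn r.integrand {z : Fin 1 → ℝ | a₀ ≤ z 0 ∧ z 0 ≤ b₀} :=
      hdom' ▸ r.integrableOn
    have hcdf : ∀ q, Cdf (of r) q = F₀ (max a₀ (min q b₀)) - F₀ a₀ := by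
      intro q
      rw [Cdf_of_succ, hdom']
      exact setIntegral_band_fin_one hab₀ hint hcont₀ hderiv₀ q
    -- semialgebraicity of the clamp composite on the window
    have hW : IsSemialgebraic ℝ window01 := isSemialgebraic_window
    have hu : IsSemialgebraicFunOn ℝ window01 (fun x => 2 + x 0) :=
      (isSemialgebraicFunOn_aeval hW (MvPolynomial.C 2 + MvPolynomial.X 0)).congr fun x _ => by simp
    have hca : IsSemialgebraicFunOn ℝ window01 (fun _ => a₀) := windowSemialg_const_fun a₀
    have hcb : IsSemialgebraicFunOn ℝ window01 (fun _ => b₀) := windowSemialg_const_fun b₀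
    have hclamp : IsSemialgebraicFunOn ℝ window01 (fun x => max a₀ (min (2 + x 0) b₀)) :=
      IsSemialgebraicFunOn.max' hca (IsSemialgebraicFunOn.min' hu hcb)
    set Ψ : (Fin 1 → ℝ) → (Fin 1 → ℝ) := fun x _ => max a₀ (min (2 + x 0) b₀) with hΨ
    have hΨsa : IsSemialgebraicMapOn ℝ window01 Ψ := IsSemialgebraicMapOn.of_forall hW fun _ => hclamp
    have hmaps : MapsTo Ψ window01 {z : Fin 1 → ℝ | a₀ ≤ z 0 ∧ z 0 ≤ b₀} := fun x _ =>
      ⟨le_max_left _ _, max_le hab₀ (min_le_right _ _)⟩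
    have hFℝ : IsSemialgebraicFunOn ℝ {z : Fin 1 → ℝ | a₀ ≤ z 0 ∧ z 0 ≤ b₀} F := by
      rw [hdom'] at hF
      exact SemialgebraicMonotonicity.isSemialgebraic_real_of hF
    have hcomp : IsSemialgebraicFunOn ℝ window01 (F ∘ Ψ) :=
      IsSemialgebraicFunOn.comp_isSemialgebraicMapOn_holds hFℝ hΨsa hmaps
    have hconst : IsSemialgebraicFunOn ℝ window01 (fun _ => F₀ a₀) := windowSemialg_const_fun (F₀ a₀)
    have hG : IsSemialgebraicFunOn ℝ window01 ((F ∘ Ψ) - fun _ => F₀ a₀) :=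
      IsSemialgebraicFunOn.sub_holds hcomp hconst
    refine ⟨(F ∘ Ψ) - fun _ => F₀ a₀, hG, fun s _ => ?_⟩
    rw [hcdf]
    rfl
  · have hdom' : r.domain = ∅ := by
      rw [hdom]
      ext z
      simp [hinit z, hτ]
    have h0 : Cdf (of r) = 0 := by
      funext q
      rw [Cdf_of_succ, hdom']
      simp
    rw [h0]
    exact WindowSemialg.zero

end Summit.KontsevichZagierPeriods.CompleteModGammaSectorNegative
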